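import Literature.NumberTheory.EllipticCurves.ManinConstantDeuringTwistProofs
import Literature.NumberTheory.EllipticCurves.ManinConstantSemistablePrimewise
import HarnessLib

/-!
# Route `EisensteinDepletionAtTwo`, crux `StarGO2Sigma` (item stmt-BirchSwinnertonDyer-27046), registered line `kummer` v7.4
# (skeleton sha16 8cbed8108921a732): the print stub `stub_maninPrint` REDUCES TO ONE NAMED FACT (Abbes–Ullmo Thm. A)

The registered stub `stub_maninPrint` of line `kummer` is the conjunction of two named published facts about the Manin constant of the
`X₀(N)`-optimal curve: Edixhoven 1991 Prop. 2 (`edixhoven_optimalManinConstant_integral`: `c₀ ∈ ℤ`) and Abbes–Ullmo 1996 Thm. A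
(`abbesUllmo_not_dvd_maninConstant_of_not_dvd_level`: `p ∤ N ⇒ p ∤ c₀`).  The first conjunct is a TREE THEOREM
(`edixhoven_optimalManinConstant_integral_holds`, Literature/…/ManinConstantDeuringTwistProofs: prime by prime through the formal group), so the
stub's open content is exactly the second: `stub_maninPrint_of_abbesUllmo : abbesUllmo_not_dvd_maninConstant_of_not_dvd_level → stub_maninPrint`
(verbatim the registered signature as conclusion).

HONEST FRAMING: CONDITIONAL on the one named fact (Abbes–Ullmo Thm. A, whose `p = 2 ∤ N` unit direction is not reachable by the tree's
formal-group engines — lead star-p1 GEN 21 audit, Cruxes/DepletedLambdaLawAtTwoMod/PICKED.md); the registered stub is NOT closed; item 27046, the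
leaf T-r3₂ and BSD are NOT proved; nothing here reads an analytic rank (PARTITION D-0054: none — axis S0, no S0 motion).  No `sorry`, no definition.
-/

set_option linter.dupNamespace false
set_option autoImplicit false

namespace Summit.BirchSwinnertonDyer.BirchSwinnertonDyer.Theorems.DepletionAtTwo.Kummer

open Literature.NumberTheory.EllipticCurves Literature.NumberTheory.EllipticCurves.ModularForms

/-- **Registered stub `stub_maninPrint` of line `kummer` (crux `StarGO2Sigma`, 27046) from Abbes–Ullmo Thm. A alone** — Edixhoven's integrality
conjunct is the tree theorem `edixhoven_optimalManinConstant_integral_holds`.  CONDITIONAL (one named fact); closes nothing by name.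
[cite: EdixhovenManin1991, Prop. 2] [cite: AbbesUllmo1996, Thm. A] -/
theorem stub_maninPrint_of_abbesUllmo (hAU : abbesUllmo_not_dvd_maninConstant_of_not_dvd_level) :
    edixhoven_optimalManinConstant_integral ∧ abbesUllmo_not_dvd_maninConstant_of_not_dvd_level :=
  ⟨edixhoven_optimalManinConstant_integral_holds, hAU⟩

end Summit.BirchSwinnertonDyer.BirchSwinnertonDyer.Theorems.DepletionAtTwo.Kummer
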